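import Literature.MathematicalPhysics.QuantumFieldTheory.Balaban1983to89.B9Eq326ConjugatedDeltaALetters

/-!
# `Balaban1983to89.B9Eq326ConjugatedDeltaAResolvent` — T. Bałaban, *Propagators for lattice gauge theories in a background field*, Commun. Math. Phys. **99**
# (1985) 389–434 [Balaban1985BackgroundPropagators] (3.26) p. 395, (3.21)∕(3.25) p. 394, (3.49) p. 399, Thm 3.11 p. 416, (3.126) p. 420 with [Balaban1985Variational]
# (45) p. 285, (110) p. 294: **ENERGY LETTERS OF THE CONJUGATED `Δ_a`-SHAPED INVERSE AND THE RESOLVENT COMPARISON `‖G_κ − G‖ ≤ β·c_β + ρ·c_ρ + β_K·c_K`** —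
# for `H = B₁†B₁ + B₂†RB₂ + K + aQ†Q` (the projected square of `B9Eq326ConjugatedDeltaALetters`): the form half `(1∕6)(‖B₁f‖² + ‖R(B₂f)‖² + a‖Qf‖²) ≤ re⟪f, H_κf⟫`,
# hence `‖B₁G_κ‖, ‖R B₂G_κ‖, ‖G_κB₁†‖, ‖G_κB₂†R‖ ≤ 8∕γ`, `‖B₂G_κ‖, ‖G_κB₂†‖ ≤ 8∕γ + (4∕γ)C_P` (the complementary part through `C_P`, NO `‖B₂‖`), and the
# resolvent identity `G_κ − G = G_κ(H − H_κ)G` term by term — abstract finite-dimensional `𝕜`-Hilbert letters; the `Δ_a` twin of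
# `B9Eq349ConjugatedGreenLetters` §1–§2 (`norm_D_Gk_le`, `norm_Gk_adjD_le`, `norm_Gk_sub_G_le`), the input of the seams `G₁Q†`, `QG₁` and of the second Gram
# operator `QG₁Q†` ((3.126), (45): `H₁ = G₁Q*(QG₁Q*)⁻¹`) on road ΔA-CT

statement-level skeleton of published theorems with citation tags; proofs where landed; nothing here is a claim about the Yang–Mills mass gap

CITATION HEADER (lean-in-tree rule).  Audit cell `pub-balaban`, sub-cell `t4`, BINDER row NE9; filed by NE9 formalisation-swarm leaf prover 03
(`b2b-balaban-t4-ne9-formalise-leaf-03`, gen 75).  Imports this lineage's `B9Eq326ConjugatedDeltaALetters` (through it ne9-leaf-05's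
`B9Eq349ConjugatedGreenLetters.re_inner_perturbed`); Mathlib otherwise.  Sources READ first-hand (`paper:balaban1985-cmp99-background-propagators`): p. 395 (3.26),
p. 394 (3.21)∕(3.25), p. 399 (3.49), p. 416 Thm 3.11, p. 420 (3.126); [Balaban1985Variational] p. 285 (45), p. 294 (110).  The conjugation is the ROUTE's
Combes–Thomas substitute; nothing of print's is asserted.

WHAT IS PROVED (sorry-free; proof lane — no `def`; [folklore] Hilbert-space algebra).  Letters as in `B9Eq326ConjugatedDeltaALetters` §2 plus: `γ ≤ 1`,
`β ≤ 1`, `R` symmetric (`⟪Rx, y⟫ = ⟪x, Ry⟫`), `‖Qf‖ ≤ C_Q‖f‖`, the left inverse `G_κH_κ = 1`, and an unconjugated right inverse `G` (`HG = 1`).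
* §1 **`forms_le_re_inner_Hk`** — `(1∕6)(‖B₁f‖² + ‖R(B₂f)‖² + a‖Qf‖²) ≤ re⟪f, H_κf⟫` on the window.
* §2 `norm_B1_Gk_le`, `norm_RB2_Gk_le`, **`norm_B2_Gk_le`** (`≤ 8∕γ + (4∕γ)C_P`), `norm_Gk_adjB1_le`, `norm_Gk_adjB2_R_le`, `norm_adj_complB2_le`
  (`‖B₂†(e − Re)‖ ≤ C_P‖e‖`), **`norm_Gk_adjB2_le`**, `norm_adjQ_le`, and the unconjugated readings `norm_B1_G_le`, `norm_B2_G_le`.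
* §3 **`norm_Gk_sub_G_le`** — `‖G_κv − Gv‖ ≤ (β·c_β + ρ·c_ρ + β_K·(4∕γ)²)·‖v‖` with
  `c_β = (4∕γ)(5·(8∕γ) + 3·(8∕γ + (4∕γ)C_P) + 3·(4∕γ) + a(4∕γ)(2C_Q + 1))`, `c_ρ = (8∕γ + (4∕γ)C_P)·(8∕γ + (4∕γ)C_P + 4∕γ)`.
HONEST SCOPE.  Abstract letters; no lattice; `γ`, `C_P`, `C_Q`, `κ₁` (inside `C_P`) displayed; no number; NOT NE9 (cell pub-balaban: NE9 NOT PRINTED ∕ NOT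
PROVED; «NE9 ⇐ the named binders»; row WALLED ON A MODEL (O-NE9-1; #5 UNRULED); spine PROVED 0∕9; rung (B)+1 on a finite T⁴ — NOT infinite volume, NOT mass gap,
NOT BetaPertH, NOT Clay; HONEST DEPENDENCY: continuum YM on T⁴ ⇐ BetaPertH ∧ nine spine estimates (0/9 proved); BetaPertH ⇐ (D1) ∧ (D4) ∧ CAP+tail).  NEW file;
nothing modified.  Net new unproved facts: 0.
-/

noncomputable section

open scoped InnerProductSpace ComplexConjugate

namespace Literature.MathematicalPhysics.QuantumFieldTheory.Balaban1983to89.B9Eq326ConjugatedDeltaAResolvent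

open B9Eq349ConjugatedGreenLetters (re_inner_perturbed)
open B9Eq326ConjugatedDeltaALetters (re_inner_projected_perturbed re_inner_H_eq coercive_k_projected norm_Gk_le_projected norm_G_le_projected)

variable {𝕜 : Type*} [RCLike 𝕜]
  {E : Type*} [NormedAddCommGroup E] [InnerProductSpace 𝕜 E] [FiniteDimensional 𝕜 E]
  {P : Type*} [NormedAddCommGroup P] [InnerProductSpace 𝕜 P] [FiniteDimensional 𝕜 P]
  {S : Type*} [NormedAddCommGroup S] [InnerProductSpace 𝕜 S] [FiniteDimensional 𝕜 S]
  {F : Type*} [NormedAddCommGroup F] [InnerProductSpace 𝕜 F] [FiniteDimensional 𝕜 F]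

section RealPart
variable {V : Type*} [NormedAddCommGroup V] [InnerProductSpace 𝕜 V]

/-- `re⟪x, y⟫ ≤ ‖x‖‖y‖`. [folklore] [cite: Balaban1985BackgroundPropagators, (3.11) p.392] -/
private theorem re_inner_le_mul_norm' (x y : V) : RCLike.re ⟪x, y⟫_𝕜 ≤ ‖x‖ * ‖y‖ :=
  (RCLike.re_le_norm _).trans (norm_inner_le_norm x y)

/-- `−‖x‖‖y‖ ≤ re⟪x, y⟫`. [folklore] [cite: Balaban1985BackgroundPropagators, (3.11) p.392] -/
private theorem neg_mul_norm_le_re_inner' (x y : V) : -(‖x‖ * ‖y‖) ≤ RCLike.re ⟪x, y⟫_𝕜 := by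
  have h1 := (abs_le.1 (RCLike.abs_re_le_norm ⟪x, y⟫_𝕜)).1
  have h2 := norm_inner_le_norm (𝕜 := 𝕜) x y
  linarith

/-- `X² ≤ cXr`, `0 ≤ c, r` gives `X ≤ cr` for `X = ‖x‖`. [folklore] [cite: Balaban1985BackgroundPropagators, (3.11) p.392] -/
private theorem norm_le_of_sq_le_mul' {x : V} {c r : ℝ} (hc : 0 ≤ c) (hr : 0 ≤ r) (h : ‖x‖ ^ 2 ≤ c * ‖x‖ * r) : ‖x‖ ≤ c * r := by
  by_cases hx : x = 0
  · simp [hx]; positivity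
  · have hxpos : 0 < ‖x‖ := norm_pos_iff.mpr hx
    nlinarith [h, hxpos]

end RealPart

section Family

variable (B₁ : E →ₗ[𝕜] P) (B₂ : E →ₗ[𝕜] S) (R : S →ₗ[𝕜] S) (Q : E →ₗ[𝕜] F) (K H : E →ₗ[𝕜] E) (a γ β βK pK ρ CP CQ : ℝ)
  (B₁k : E →ₗ[𝕜] P) (B₁k' : P →ₗ[𝕜] E) (B₂k : E →ₗ[𝕜] S) (B₂k' : S →ₗ[𝕜] E) (Rk : S →ₗ[𝕜] S) (Qk : E →ₗ[𝕜] F) (Qk' : F →ₗ[𝕜] E)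
  (Kk Hk Gk : E →ₗ[𝕜] E)
  (ha : 0 ≤ a) (hγ : 0 < γ) (hγ1 : γ ≤ 1) (hβ : 0 ≤ β) (hβ1 : β ≤ 1) (hβK : 0 ≤ βK) (hρ : 0 ≤ ρ) (hρ8 : ρ ≤ 1 / 8) (hCP : 0 ≤ CP) (hCQ : 0 ≤ CQ)
  (hRsq : ∀ s, RCLike.re ⟪s, R s⟫_𝕜 = ‖R s‖ ^ 2) (hR1 : ∀ s, ‖R s‖ ≤ ‖s‖) (hRsa : ∀ x y, ⟪R x, y⟫_𝕜 = ⟪x, R y⟫_𝕜)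
  (hH : ∀ f, H f = LinearMap.adjoint B₁ (B₁ f) + LinearMap.adjoint B₂ (R (B₂ f)) + K f + ((a : ℝ) : 𝕜) • LinearMap.adjoint Q (Q f))
  (coercive : ∀ f, γ * ‖f‖ ^ 2 ≤ RCLike.re ⟪f, H f⟫_𝕜)
  (hKre : ∀ f, -(pK * ‖f‖ ^ 2) ≤ RCLike.re ⟪f, K f⟫_𝕜)
  (hP : ∀ f, ‖B₂ f - R (B₂ f)‖ ≤ CP * ‖f‖) (hQ : ∀ f, ‖Q f‖ ≤ CQ * ‖f‖)
  (dB₁ : ∀ f, ‖B₁k f - B₁ f‖ ≤ β * ‖f‖) (dB₁' : ∀ p, ‖B₁k' p - LinearMap.adjoint B₁ p‖ ≤ β * ‖p‖)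
  (dB₂ : ∀ f, ‖B₂k f - B₂ f‖ ≤ β * ‖f‖) (dB₂' : ∀ s, ‖B₂k' s - LinearMap.adjoint B₂ s‖ ≤ β * ‖s‖)
  (dR : ∀ s, ‖Rk s - R s‖ ≤ ρ * ‖s‖)
  (dQ : ∀ f, ‖Qk f - Q f‖ ≤ β * ‖f‖) (dQ' : ∀ g, ‖Qk' g - LinearMap.adjoint Q g‖ ≤ β * ‖g‖)
  (dK : ∀ f, ‖Kk f - K f‖ ≤ βK * ‖f‖)
  (small : pK / 2 + (21 + 3 * a) * β ^ 2 + 4 * β * CP + 2 * ρ * CP ^ 2 + βK ≤ γ / 4)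
  (hHk : ∀ f, Hk f = B₁k' (B₁k f) + B₂k' (Rk (B₂k f)) + Kk f + ((a : ℝ) : 𝕜) • Qk' (Qk f)) (hHkGk : ∀ v, Hk (Gk v) = v)

/-! ## §1 The form half of the perturbed coercivity -/

include ha hβ hβK hρ hρ8 hCP hRsq hR1 hH coercive hKre hP dB₁ dB₁' dB₂ dB₂' dR dQ dQ' dK small hHk in
/-- **`(1∕6)(‖B₁f‖² + ‖R(B₂f)‖² + a‖Qf‖²) ≤ re⟪f, H_κf⟫`** on the window: the three perturbed squares give `re⟪f, H_κf⟫ ≥ ½Σ + re⟪f, Kf⟫ − loss·‖f‖²` with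
`loss ≤ γ∕4 − p_K∕2`, `re⟪f, Kf⟫ ≥ −p_K‖f‖²`, `p_K ≤ γ∕2`, and `‖f‖² ≤ (4∕γ)re⟪f, H_κf⟫` (`coercive_k_projected`). [folklore]
[cite: Balaban1985BackgroundPropagators, (3.26) p.395, (3.49) p.399, Thm 3.11 p.416] -/
theorem forms_le_re_inner_Hk (f : E) :
    1 / 6 * (‖B₁ f‖ ^ 2 + ‖R (B₂ f)‖ ^ 2 + a * ‖Q f‖ ^ 2) ≤ RCLike.re ⟪f, Hk f⟫_𝕜 := by
  have co := coercive_k_projected B₁ B₂ R Q K H a γ β βK pK ρ CP B₁k B₁k' B₂k B₂k' Rk Qk Qk' Kk Hk ha hβ hρ hCP hRsq hR1 hH coercive hKre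
    dB₁ dB₁' dB₂ dB₂' dR dQ dQ' dK small hHk hρ8 hP f
  have e : RCLike.re ⟪f, Hk f⟫_𝕜 = RCLike.re ⟪f, B₁k' (B₁k f)⟫_𝕜 + RCLike.re ⟪f, B₂k' (Rk (B₂k f))⟫_𝕜 + RCLike.re ⟪f, Kk f⟫_𝕜 +
      a * RCLike.re ⟪f, Qk' (Qk f)⟫_𝕜 := by
    rw [hHk, inner_add_right, inner_add_right, inner_add_right, map_add, map_add, map_add, inner_smul_real_right, RCLike.smul_re]
  have p1 := re_inner_perturbed B₁ B₁k B₁k' hβ dB₁ dB₁' f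
  have p2 := re_inner_projected_perturbed B₂ R B₂k B₂k' Rk hβ hρ hρ8 hCP hRsq hR1 dB₂ dB₂' dR hP f
  have pQ := mul_le_mul_of_nonneg_left (re_inner_perturbed Q Qk Qk' hβ dQ dQ' f) ha
  have pK' : RCLike.re ⟪f, K f⟫_𝕜 - βK * ‖f‖ ^ 2 ≤ RCLike.re ⟪f, Kk f⟫_𝕜 := by
    have e1 : ⟪f, Kk f⟫_𝕜 = ⟪f, K f⟫_𝕜 + ⟪f, Kk f - K f⟫_𝕜 := by rw [← inner_add_right, add_sub_cancel]
    rw [e1, map_add]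
    have h1 := neg_mul_norm_le_re_inner' (𝕜 := 𝕜) f (Kk f - K f)
    have h2 : ‖f‖ * ‖Kk f - K f‖ ≤ ‖f‖ * (βK * ‖f‖) := mul_le_mul_of_nonneg_left (dK f) (norm_nonneg _)
    nlinarith [h1, h2]
  have hk := hKre f
  have hq : 0 ≤ a * ‖Q f‖ ^ 2 := by positivity
  have sm := mul_le_mul_of_nonneg_right small (sq_nonneg ‖f‖)
  have t0 : 0 ≤ ((21 + 3 * a) * β ^ 2 + 4 * β * CP + 2 * ρ * CP ^ 2 + βK) * ‖f‖ ^ 2 := by positivity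
  nlinarith [co, e, p1, p2, pQ, pK', hk, hq, sm, t0, sq_nonneg ‖f‖]

/-! ## §2 Energy letters of `G_κ` -/

include ha hγ hγ1 hβ hβK hρ hρ8 hCP hRsq hR1 hH coercive hKre hP dB₁ dB₁' dB₂ dB₂' dR dQ dQ' dK small hHk hHkGk in
/-- **`‖B₁(G_κv)‖ ≤ (8∕γ)‖v‖`** (`(1∕6)‖B₁f‖² ≤ re⟪f, v⟫ ≤ ‖f‖‖v‖ ≤ (4∕γ)‖v‖²`, `γ ≤ 1`). [folklore] [cite: Balaban1985BackgroundPropagators, (3.26) p.395, Thm 3.11 p.416] -/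
theorem norm_B1_Gk_le (v : E) : ‖B₁ (Gk v)‖ ≤ 8 / γ * ‖v‖ := by
  have h1 := forms_le_re_inner_Hk B₁ B₂ R Q K H a γ β βK pK ρ CP B₁k B₁k' B₂k B₂k' Rk Qk Qk' Kk Hk ha hβ hβK hρ hρ8 hCP hRsq hR1 hH
    coercive hKre hP dB₁ dB₁' dB₂ dB₂' dR dQ dQ' dK small hHk (Gk v)
  rw [hHkGk] at h1
  have h2 := re_inner_le_mul_norm' (𝕜 := 𝕜) (Gk v) v
  have h3 := norm_Gk_le_projected B₁ B₂ R Q K H a γ β βK pK ρ CP B₁k B₁k' B₂k B₂k' Rk Qk Qk' Kk Hk Gk ha hγ hβ hρ hCP hRsq hR1 hH coercive hKre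
    dB₁ dB₁' dB₂ dB₂' dR dQ dQ' dK small hHk hHkGk hρ8 hP v
  have hq : 0 ≤ a * ‖Q (Gk v)‖ ^ 2 := by positivity
  have h4 : ‖B₁ (Gk v)‖ ^ 2 ≤ 6 * (4 / γ * ‖v‖) * ‖v‖ := by
    have := mul_le_mul_of_nonneg_right h3 (norm_nonneg v)
    nlinarith [h1, h2, this, hq, sq_nonneg ‖R (B₂ (Gk v))‖]
  have h5 : 6 * (4 / γ * ‖v‖) * ‖v‖ ≤ (8 / γ * ‖v‖) ^ 2 := by
    rw [show 6 * (4 / γ * ‖v‖) * ‖v‖ = (24 / γ) * ‖v‖ ^ 2 by ring, show (8 / γ * ‖v‖) ^ 2 = (64 / γ ^ 2) * ‖v‖ ^ 2 by ring]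
    apply mul_le_mul_of_nonneg_right _ (sq_nonneg _)
    rw [div_le_div_iff₀ hγ (by positivity)]
    nlinarith
  exact (sq_le_sq₀ (norm_nonneg _) (by positivity)).1 (h4.trans h5)

include ha hγ hγ1 hβ hβK hρ hρ8 hCP hRsq hR1 hH coercive hKre hP dB₁ dB₁' dB₂ dB₂' dR dQ dQ' dK small hHk hHkGk in
/-- **`‖R(B₂(G_κv))‖ ≤ (8∕γ)‖v‖`.** [folklore] [cite: Balaban1985BackgroundPropagators, (3.26) p.395, (3.21) p.394, Thm 3.11 p.416] -/
theorem norm_RB2_Gk_le (v : E) : ‖R (B₂ (Gk v))‖ ≤ 8 / γ * ‖v‖ := by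
  have h1 := forms_le_re_inner_Hk B₁ B₂ R Q K H a γ β βK pK ρ CP B₁k B₁k' B₂k B₂k' Rk Qk Qk' Kk Hk ha hβ hβK hρ hρ8 hCP hRsq hR1 hH
    coercive hKre hP dB₁ dB₁' dB₂ dB₂' dR dQ dQ' dK small hHk (Gk v)
  rw [hHkGk] at h1
  have h2 := re_inner_le_mul_norm' (𝕜 := 𝕜) (Gk v) v
  have h3 := norm_Gk_le_projected B₁ B₂ R Q K H a γ β βK pK ρ CP B₁k B₁k' B₂k B₂k' Rk Qk Qk' Kk Hk Gk ha hγ hβ hρ hCP hRsq hR1 hH coercive hKre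
    dB₁ dB₁' dB₂ dB₂' dR dQ dQ' dK small hHk hHkGk hρ8 hP v
  have hq : 0 ≤ a * ‖Q (Gk v)‖ ^ 2 := by positivity
  have h4 : ‖R (B₂ (Gk v))‖ ^ 2 ≤ 6 * (4 / γ * ‖v‖) * ‖v‖ := by
    have := mul_le_mul_of_nonneg_right h3 (norm_nonneg v)
    nlinarith [h1, h2, this, hq, sq_nonneg ‖B₁ (Gk v)‖]
  have h5 : 6 * (4 / γ * ‖v‖) * ‖v‖ ≤ (8 / γ * ‖v‖) ^ 2 := by
    rw [show 6 * (4 / γ * ‖v‖) * ‖v‖ = (24 / γ) * ‖v‖ ^ 2 by ring, show (8 / γ * ‖v‖) ^ 2 = (64 / γ ^ 2) * ‖v‖ ^ 2 by ring]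
    apply mul_le_mul_of_nonneg_right _ (sq_nonneg _)
    rw [div_le_div_iff₀ hγ (by positivity)]
    nlinarith
  exact (sq_le_sq₀ (norm_nonneg _) (by positivity)).1 (h4.trans h5)

include ha hγ hγ1 hβ hβK hρ hρ8 hCP hRsq hR1 hH coercive hKre hP dB₁ dB₁' dB₂ dB₂' dR dQ dQ' dK small hHk hHkGk in
/-- **`‖B₂(G_κv)‖ ≤ (8∕γ + (4∕γ)C_P)‖v‖`** — the divergence of the conjugated inverse: the projected part by the form, the complementary part by `C_P`.
[folklore] [cite: Balaban1985BackgroundPropagators, (3.26) p.395, (3.21) p.394, (3.49) p.399, Thm 3.11 p.416] -/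
theorem norm_B2_Gk_le (v : E) : ‖B₂ (Gk v)‖ ≤ (8 / γ + 4 / γ * CP) * ‖v‖ := by
  have h1 := norm_RB2_Gk_le B₁ B₂ R Q K H a γ β βK pK ρ CP B₁k B₁k' B₂k B₂k' Rk Qk Qk' Kk Hk Gk ha hγ hγ1 hβ hβK hρ hρ8 hCP hRsq hR1 hH coercive
    hKre hP dB₁ dB₁' dB₂ dB₂' dR dQ dQ' dK small hHk hHkGk v
  have h2 := hP (Gk v)
  have h3 := norm_Gk_le_projected B₁ B₂ R Q K H a γ β βK pK ρ CP B₁k B₁k' B₂k B₂k' Rk Qk Qk' Kk Hk Gk ha hγ hβ hρ hCP hRsq hR1 hH coercive hKre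
    dB₁ dB₁' dB₂ dB₂' dR dQ dQ' dK small hHk hHkGk hρ8 hP v
  have h4 := norm_le_norm_add_norm_sub' (B₂ (Gk v)) (R (B₂ (Gk v)))
  have h5 : CP * ‖Gk v‖ ≤ CP * (4 / γ * ‖v‖) := mul_le_mul_of_nonneg_left h3 hCP
  nlinarith [h1, h2, h4, h5]

include ha hγ hγ1 hβ hβK hρ hρ8 hCP hRsq hR1 hH coercive hKre hP dB₁ dB₁' dB₂ dB₂' dR dQ dQ' dK small hHk hHkGk in
/-- **`‖G_κ(B₁†p)‖ ≤ (8∕γ)‖p‖`** (form level: `re⟪f, H_κf⟫ = re⟪B₁f, p⟫` for `f = G_κ(B₁†p)`; no `‖B₁†‖` appears).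
[folklore] [cite: Balaban1985BackgroundPropagators, (3.26) p.395, (3.49) p.399, Thm 3.11 p.416] -/
theorem norm_Gk_adjB1_le (p : P) : ‖Gk (LinearMap.adjoint B₁ p)‖ ≤ 8 / γ * ‖p‖ := by
  have h1 := forms_le_re_inner_Hk B₁ B₂ R Q K H a γ β βK pK ρ CP B₁k B₁k' B₂k B₂k' Rk Qk Qk' Kk Hk ha hβ hβK hρ hρ8 hCP hRsq hR1 hH
    coercive hKre hP dB₁ dB₁' dB₂ dB₂' dR dQ dQ' dK small hHk (Gk (LinearMap.adjoint B₁ p))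
  have hk := coercive_k_projected B₁ B₂ R Q K H a γ β βK pK ρ CP B₁k B₁k' B₂k B₂k' Rk Qk Qk' Kk Hk ha hβ hρ hCP hRsq hR1 hH coercive hKre
    dB₁ dB₁' dB₂ dB₂' dR dQ dQ' dK small hHk hρ8 hP (Gk (LinearMap.adjoint B₁ p))
  rw [hHkGk, LinearMap.adjoint_inner_right] at h1 hk
  have h2 := re_inner_le_mul_norm' (𝕜 := 𝕜) (B₁ (Gk (LinearMap.adjoint B₁ p))) p
  have hq : 0 ≤ a * ‖Q (Gk (LinearMap.adjoint B₁ p))‖ ^ 2 := by positivity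
  have hX : ‖B₁ (Gk (LinearMap.adjoint B₁ p))‖ ≤ 6 * ‖p‖ :=
    norm_le_of_sq_le_mul' (by norm_num) (norm_nonneg p) (by nlinarith [h1, h2, hq, sq_nonneg ‖R (B₂ (Gk (LinearMap.adjoint B₁ p)))‖])
  have hu : γ / 4 * ‖Gk (LinearMap.adjoint B₁ p)‖ ^ 2 ≤ 6 * ‖p‖ ^ 2 := by nlinarith [hk, h2, hX, norm_nonneg p]
  have h5 : ‖Gk (LinearMap.adjoint B₁ p)‖ ^ 2 ≤ (8 / γ * ‖p‖) ^ 2 := by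
    rw [show (8 / γ * ‖p‖) ^ 2 = (64 / γ ^ 2) * ‖p‖ ^ 2 by ring]
    have step : ‖Gk (LinearMap.adjoint B₁ p)‖ ^ 2 ≤ (24 / γ) * ‖p‖ ^ 2 := by
      rw [show (24 / γ) * ‖p‖ ^ 2 = 24 * ‖p‖ ^ 2 / γ by ring, le_div_iff₀ hγ]; nlinarith [hu]
    refine step.trans (mul_le_mul_of_nonneg_right ?_ (sq_nonneg _))
    rw [div_le_div_iff₀ hγ (by positivity)]
    nlinarith
  exact (sq_le_sq₀ (norm_nonneg _) (by positivity)).1 h5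

include ha hγ hγ1 hβ hβK hρ hρ8 hCP hRsq hR1 hRsa hH coercive hKre hP dB₁ dB₁' dB₂ dB₂' dR dQ dQ' dK small hHk hHkGk in
/-- **`‖G_κ(B₂†(Rw))‖ ≤ (8∕γ)‖w‖`** (`re⟪f, B₂†(Rw)⟫ = re⟪R(B₂f), w⟫`, `R` symmetric). [folklore] [cite: Balaban1985BackgroundPropagators, (3.26) p.395, (3.21) p.394, Thm 3.11 p.416] -/
theorem norm_Gk_adjB2_R_le (w : S) : ‖Gk (LinearMap.adjoint B₂ (R w))‖ ≤ 8 / γ * ‖w‖ := by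
  have h1 := forms_le_re_inner_Hk B₁ B₂ R Q K H a γ β βK pK ρ CP B₁k B₁k' B₂k B₂k' Rk Qk Qk' Kk Hk ha hβ hβK hρ hρ8 hCP hRsq hR1 hH
    coercive hKre hP dB₁ dB₁' dB₂ dB₂' dR dQ dQ' dK small hHk (Gk (LinearMap.adjoint B₂ (R w)))
  have hk := coercive_k_projected B₁ B₂ R Q K H a γ β βK pK ρ CP B₁k B₁k' B₂k B₂k' Rk Qk Qk' Kk Hk ha hβ hρ hCP hRsq hR1 hH coercive hKre
    dB₁ dB₁' dB₂ dB₂' dR dQ dQ' dK small hHk hρ8 hP (Gk (LinearMap.adjoint B₂ (R w)))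
  rw [hHkGk, LinearMap.adjoint_inner_right, ← hRsa] at h1 hk
  have h2 := re_inner_le_mul_norm' (𝕜 := 𝕜) (R (B₂ (Gk (LinearMap.adjoint B₂ (R w))))) w
  have hq : 0 ≤ a * ‖Q (Gk (LinearMap.adjoint B₂ (R w)))‖ ^ 2 := by positivity
  have hX : ‖R (B₂ (Gk (LinearMap.adjoint B₂ (R w))))‖ ≤ 6 * ‖w‖ :=
    norm_le_of_sq_le_mul' (by norm_num) (norm_nonneg w) (by nlinarith [h1, h2, hq, sq_nonneg ‖B₁ (Gk (LinearMap.adjoint B₂ (R w)))‖])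
  have hu : γ / 4 * ‖Gk (LinearMap.adjoint B₂ (R w))‖ ^ 2 ≤ 6 * ‖w‖ ^ 2 := by nlinarith [hk, h2, hX, norm_nonneg w]
  have h5 : ‖Gk (LinearMap.adjoint B₂ (R w))‖ ^ 2 ≤ (8 / γ * ‖w‖) ^ 2 := by
    rw [show (8 / γ * ‖w‖) ^ 2 = (64 / γ ^ 2) * ‖w‖ ^ 2 by ring]
    have step : ‖Gk (LinearMap.adjoint B₂ (R w))‖ ^ 2 ≤ (24 / γ) * ‖w‖ ^ 2 := by
      rw [show (24 / γ) * ‖w‖ ^ 2 = 24 * ‖w‖ ^ 2 / γ by ring, le_div_iff₀ hγ]; nlinarith [hu]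
    refine step.trans (mul_le_mul_of_nonneg_right ?_ (sq_nonneg _))
    rw [div_le_div_iff₀ hγ (by positivity)]
    nlinarith
  exact (sq_le_sq₀ (norm_nonneg _) (by positivity)).1 h5

omit [FiniteDimensional 𝕜 P] [FiniteDimensional 𝕜 F] in
include hCP hRsa hP in
/-- **`‖B₂†(e − Re)‖ ≤ C_P‖e‖`** — the adjoint of the complementary part `(1 − R)B₂` (`R` symmetric): `‖x‖² = re⟪e, B₂x − R(B₂x)⟫ ≤ ‖e‖C_P‖x‖` for
`x = B₂†(e − Re)`. [folklore] [cite: Balaban1985BackgroundPropagators, (3.21) p.394, (3.49) p.399] -/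
theorem norm_adj_complB2_le (e : S) : ‖LinearMap.adjoint B₂ (e - R e)‖ ≤ CP * ‖e‖ := by
  set x := LinearMap.adjoint B₂ (e - R e) with hx
  have h1 : ‖x‖ ^ 2 = RCLike.re ⟪e, B₂ x - R (B₂ x)⟫_𝕜 := by
    rw [← inner_self_eq_norm_sq (𝕜 := 𝕜), hx, LinearMap.adjoint_inner_left, inner_sub_left, hRsa, ← inner_sub_right]
  have h2 : RCLike.re ⟪e, B₂ x - R (B₂ x)⟫_𝕜 ≤ ‖e‖ * (CP * ‖x‖) :=
    (re_inner_le_mul_norm' (𝕜 := 𝕜) e _).trans (mul_le_mul_of_nonneg_left (hP x) (norm_nonneg _))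
  exact norm_le_of_sq_le_mul' hCP (norm_nonneg e) (by nlinarith [h1, h2])

include ha hγ hγ1 hβ hβK hρ hρ8 hCP hRsq hR1 hRsa hH coercive hKre hP dB₁ dB₁' dB₂ dB₂' dR dQ dQ' dK small hHk hHkGk in
/-- **`‖G_κ(B₂†e)‖ ≤ (8∕γ + (4∕γ)C_P)‖e‖`** (`e = Re + (e − Re)`: the first part by `norm_Gk_adjB2_R_le`, the second by `‖G_κ‖ ≤ 4∕γ` and `norm_adj_complB2_le`).
[folklore] [cite: Balaban1985BackgroundPropagators, (3.26) p.395, (3.21) p.394, (3.49) p.399, Thm 3.11 p.416] -/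
theorem norm_Gk_adjB2_le (e : S) : ‖Gk (LinearMap.adjoint B₂ e)‖ ≤ (8 / γ + 4 / γ * CP) * ‖e‖ := by
  have split : Gk (LinearMap.adjoint B₂ e) = Gk (LinearMap.adjoint B₂ (R e)) + Gk (LinearMap.adjoint B₂ (e - R e)) := by
    rw [← map_add, ← map_add, add_sub_cancel]
  have h1 := norm_Gk_adjB2_R_le B₁ B₂ R Q K H a γ β βK pK ρ CP B₁k B₁k' B₂k B₂k' Rk Qk Qk' Kk Hk Gk ha hγ hγ1 hβ hβK hρ hρ8 hCP hRsq hR1 hRsa hH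
    coercive hKre hP dB₁ dB₁' dB₂ dB₂' dR dQ dQ' dK small hHk hHkGk e
  have h2 := norm_Gk_le_projected B₁ B₂ R Q K H a γ β βK pK ρ CP B₁k B₁k' B₂k B₂k' Rk Qk Qk' Kk Hk Gk ha hγ hβ hρ hCP hRsq hR1 hH coercive hKre
    dB₁ dB₁' dB₂ dB₂' dR dQ dQ' dK small hHk hHkGk hρ8 hP (LinearMap.adjoint B₂ (e - R e))
  have h3 := norm_adj_complB2_le B₂ R CP hCP hRsa hP e
  calc ‖Gk (LinearMap.adjoint B₂ e)‖ ≤ ‖Gk (LinearMap.adjoint B₂ (R e))‖ + ‖Gk (LinearMap.adjoint B₂ (e - R e))‖ := by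
        rw [split]; exact norm_add_le _ _
    _ ≤ 8 / γ * ‖e‖ + 4 / γ * (CP * ‖e‖) := add_le_add h1 (h2.trans (mul_le_mul_of_nonneg_left h3 (by positivity)))
    _ = (8 / γ + 4 / γ * CP) * ‖e‖ := by ring

omit [FiniteDimensional 𝕜 P] [FiniteDimensional 𝕜 S] in
include hCQ hQ in
/-- `‖Q†g‖ ≤ C_Q‖g‖`. [folklore] [cite: Balaban1985BackgroundPropagators, (3.15) p.393] -/
theorem norm_adjQ_le (g : F) : ‖LinearMap.adjoint Q g‖ ≤ CQ * ‖g‖ := by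
  have h1 : ‖LinearMap.adjoint Q g‖ ^ 2 ≤ CQ * ‖LinearMap.adjoint Q g‖ * ‖g‖ := by
    rw [← inner_self_eq_norm_sq (𝕜 := 𝕜), LinearMap.adjoint_inner_right]
    calc RCLike.re ⟪Q (LinearMap.adjoint Q g), g⟫_𝕜 ≤ ‖Q (LinearMap.adjoint Q g)‖ * ‖g‖ := re_inner_le_mul_norm' _ _
      _ ≤ CQ * ‖LinearMap.adjoint Q g‖ * ‖g‖ := mul_le_mul_of_nonneg_right (hQ _) (norm_nonneg _)
  exact norm_le_of_sq_le_mul' hCQ (norm_nonneg g) h1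

end Family

/-! ## §3 The resolvent comparison `G_κ − G = G_κ(H − H_κ)G` -/

section Resolvent

variable (B₁ : E →ₗ[𝕜] P) (B₂ : E →ₗ[𝕜] S) (R : S →ₗ[𝕜] S) (Q : E →ₗ[𝕜] F) (K H G : E →ₗ[𝕜] E) (a γ β βK pK ρ CP CQ : ℝ)
  (B₁k : E →ₗ[𝕜] P) (B₁k' : P →ₗ[𝕜] E) (B₂k : E →ₗ[𝕜] S) (B₂k' : S →ₗ[𝕜] E) (Rk : S →ₗ[𝕜] S) (Qk : E →ₗ[𝕜] F) (Qk' : F →ₗ[𝕜] E)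
  (Kk Hk Gk : E →ₗ[𝕜] E)
  (ha : 0 ≤ a) (hγ : 0 < γ) (hγ1 : γ ≤ 1) (hβ : 0 ≤ β) (hβ1 : β ≤ 1) (hβK : 0 ≤ βK) (hρ : 0 ≤ ρ) (hρ8 : ρ ≤ 1 / 8) (hCP : 0 ≤ CP) (hCQ : 0 ≤ CQ)
  (hRsq : ∀ s, RCLike.re ⟪s, R s⟫_𝕜 = ‖R s‖ ^ 2) (hR1 : ∀ s, ‖R s‖ ≤ ‖s‖) (hRsa : ∀ x y, ⟪R x, y⟫_𝕜 = ⟪x, R y⟫_𝕜)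
  (hH : ∀ f, H f = LinearMap.adjoint B₁ (B₁ f) + LinearMap.adjoint B₂ (R (B₂ f)) + K f + ((a : ℝ) : 𝕜) • LinearMap.adjoint Q (Q f))
  (coercive : ∀ f, γ * ‖f‖ ^ 2 ≤ RCLike.re ⟪f, H f⟫_𝕜)
  (hKre : ∀ f, -(pK * ‖f‖ ^ 2) ≤ RCLike.re ⟪f, K f⟫_𝕜)
  (hP : ∀ f, ‖B₂ f - R (B₂ f)‖ ≤ CP * ‖f‖) (hQ : ∀ f, ‖Q f‖ ≤ CQ * ‖f‖)
  (dB₁ : ∀ f, ‖B₁k f - B₁ f‖ ≤ β * ‖f‖) (dB₁' : ∀ p, ‖B₁k' p - LinearMap.adjoint B₁ p‖ ≤ β * ‖p‖)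
  (dB₂ : ∀ f, ‖B₂k f - B₂ f‖ ≤ β * ‖f‖) (dB₂' : ∀ s, ‖B₂k' s - LinearMap.adjoint B₂ s‖ ≤ β * ‖s‖)
  (dR : ∀ s, ‖Rk s - R s‖ ≤ ρ * ‖s‖)
  (dQ : ∀ f, ‖Qk f - Q f‖ ≤ β * ‖f‖) (dQ' : ∀ g, ‖Qk' g - LinearMap.adjoint Q g‖ ≤ β * ‖g‖)
  (dK : ∀ f, ‖Kk f - K f‖ ≤ βK * ‖f‖)
  (small : pK / 2 + (21 + 3 * a) * β ^ 2 + 4 * β * CP + 2 * ρ * CP ^ 2 + βK ≤ γ / 4)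
  (hHk : ∀ f, Hk f = B₁k' (B₁k f) + B₂k' (Rk (B₂k f)) + Kk f + ((a : ℝ) : 𝕜) • Qk' (Qk f))
  (hHG : ∀ v, H (G v) = v) (hHkGk : ∀ v, Hk (Gk v) = v) (hGkHk : ∀ s, Gk (Hk s) = s)

include ha hγ hγ1 hCP hRsq hR1 hH coercive hKre hP hHG in
/-- `‖B₁(Gv)‖ ≤ (8∕γ)‖v‖` — the unconjugated reading (`p_K ≤ γ∕2`). [folklore] [cite: Balaban1985BackgroundPropagators, (3.26) p.395, Thm 3.11 p.416] -/
theorem norm_B1_G_le (small0 : pK / 2 ≤ γ / 4) (v : E) : ‖B₁ (G v)‖ ≤ 8 / γ * ‖v‖ :=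
  norm_B1_Gk_le B₁ B₂ R Q K H a γ 0 0 pK 0 CP B₁ (LinearMap.adjoint B₁) B₂ (LinearMap.adjoint B₂) R Q (LinearMap.adjoint Q) K H G ha hγ hγ1 le_rfl
    le_rfl le_rfl (by norm_num) hCP hRsq hR1 hH coercive hKre hP (fun f => by simp) (fun p => by simp) (fun f => by simp) (fun s => by simp)
    (fun s => by simp) (fun f => by simp) (fun g => by simp) (fun f => by simp) (by nlinarith) hH hHG v

include ha hγ hγ1 hCP hRsq hR1 hH coercive hKre hP hHG in
/-- `‖B₂(Gv)‖ ≤ (8∕γ + (4∕γ)C_P)‖v‖` — the unconjugated reading. [folklore] [cite: Balaban1985BackgroundPropagators, (3.26) p.395, (3.21) p.394, Thm 3.11 p.416] -/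
theorem norm_B2_G_le (small0 : pK / 2 ≤ γ / 4) (v : E) : ‖B₂ (G v)‖ ≤ (8 / γ + 4 / γ * CP) * ‖v‖ :=
  norm_B2_Gk_le B₁ B₂ R Q K H a γ 0 0 pK 0 CP B₁ (LinearMap.adjoint B₁) B₂ (LinearMap.adjoint B₂) R Q (LinearMap.adjoint Q) K H G ha hγ hγ1 le_rfl
    le_rfl le_rfl (by norm_num) hCP hRsq hR1 hH coercive hKre hP (fun f => by simp) (fun p => by simp) (fun f => by simp) (fun s => by simp)
    (fun s => by simp) (fun f => by simp) (fun g => by simp) (fun f => by simp) (by nlinarith) hH hHG v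

include ha hγ hγ1 hβ hβ1 hβK hρ hρ8 hCP hCQ hRsq hR1 hRsa hH coercive hKre hP hQ dB₁ dB₁' dB₂ dB₂' dR dQ dQ' dK small hHk hHG hHkGk hGkHk in
/-- **THE RESOLVENT COMPARISON `‖G_κv − Gv‖ ≤ (β·c_β + ρ·c_ρ + β_K·(4∕γ)²)·‖v‖`** — `G_κ − G = G_κ(H − H_κ)G` with
`H − H_κ = B₁†(B₁ − B_{1,κ}) + (B₁† − B′_{1,κ})B_{1,κ} + B₂†R(B₂ − B_{2,κ}) + B₂†(R − R_κ)B_{2,κ} + (B₂† − B′_{2,κ})R_κB_{2,κ} + (K − K_κ) + a(Q†(Q − Q_κ) + (Q† − Q′_κ)Q_κ)`,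
eight terms, each bounded by §2's letters (`g = 4∕γ`, `b₁ = 8∕γ`, `b₂ = 8∕γ + gC_P`):
`c_β = g·(2b₁ + (b₁ + g) + 2(b₂ + g) + aC_Q·g + a(C_Q + 1)·g)`, `c_ρ = b₂·(b₂ + g)`. [folklore]
[cite: Balaban1985BackgroundPropagators, (3.26) p.395, (3.21) p.394, (3.49) p.399, Thm 3.11 p.416, (3.126) p.420; Balaban1985Variational, (45) p.285] -/
theorem norm_Gk_sub_G_le (v : E) :
    ‖Gk v - G v‖ ≤
      (β * (4 / γ * (2 * (8 / γ) + (8 / γ + 4 / γ) + 2 * ((8 / γ + 4 / γ * CP) + 4 / γ) + a * CQ * (4 / γ) + a * (CQ + 1) * (4 / γ))) +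
        ρ * ((8 / γ + 4 / γ * CP) * ((8 / γ + 4 / γ * CP) + 4 / γ)) + βK * (4 / γ) ^ 2) * ‖v‖ := by
  have small0 : pK / 2 ≤ γ / 4 := by
    have : 0 ≤ (21 + 3 * a) * β ^ 2 + 4 * β * CP + 2 * ρ * CP ^ 2 + βK := by positivity
    linarith
  -- the identity
  have key : Gk v - G v =
      Gk (LinearMap.adjoint B₁ (B₁ (G v) - B₁k (G v))) + Gk ((LinearMap.adjoint B₁ (B₁k (G v)) - B₁k' (B₁k (G v))))
      + Gk (LinearMap.adjoint B₂ (R (B₂ (G v) - B₂k (G v)))) + Gk (LinearMap.adjoint B₂ (R (B₂k (G v)) - Rk (B₂k (G v))))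
      + Gk (LinearMap.adjoint B₂ (Rk (B₂k (G v))) - B₂k' (Rk (B₂k (G v))))
      + Gk (K (G v) - Kk (G v))
      + ((a : ℝ) : 𝕜) • (Gk (LinearMap.adjoint Q (Q (G v) - Qk (G v))) + Gk (LinearMap.adjoint Q (Qk (G v)) - Qk' (Qk (G v)))) := by
    have : Gk v - G v = Gk (H (G v)) - Gk (Hk (G v)) := by rw [hHG, hGkHk]
    rw [this, hH, hHk]; simp only [map_sub, map_add, map_smul, smul_sub, smul_add]; abel
  set u := G v with hu
  -- sizes of `u` and its images
  have g0 : (0 : ℝ) ≤ 4 / γ := by positivity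
  have nu : ‖u‖ ≤ 4 / γ * ‖v‖ := norm_G_le_projected B₁ B₂ R Q K H G a γ pK CP ha hγ hCP hRsq hR1 hH coercive hKre small0 hHG hP v
  have nB1u : ‖B₁ u‖ ≤ 8 / γ * ‖v‖ := norm_B1_G_le B₁ B₂ R Q K H G a γ pK CP ha hγ hγ1 hCP hRsq hR1 hH coercive hKre hP hHG small0 v
  have nB2u : ‖B₂ u‖ ≤ (8 / γ + 4 / γ * CP) * ‖v‖ := norm_B2_G_le B₁ B₂ R Q K H G a γ pK CP ha hγ hγ1 hCP hRsq hR1 hH coercive hKre hP hHG small0 v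
  have nB1ku : ‖B₁k u‖ ≤ (8 / γ + 4 / γ) * ‖v‖ := by
    have := norm_le_norm_add_norm_sub' (B₁k u) (B₁ u)
    have h := dB₁ u
    nlinarith [nB1u, nu, hβ1, norm_nonneg u]
  have nB2ku : ‖B₂k u‖ ≤ ((8 / γ + 4 / γ * CP) + 4 / γ) * ‖v‖ := by
    have := norm_le_norm_add_norm_sub' (B₂k u) (B₂ u)
    have h := dB₂ u
    nlinarith [nB2u, nu, hβ1, norm_nonneg u]
  have nRk : ∀ s, ‖Rk s‖ ≤ 2 * ‖s‖ := fun s => by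
    have := norm_add_le (R s) (Rk s - R s)
    rw [add_sub_cancel] at this
    nlinarith [hR1 s, dR s, norm_nonneg s]
  have nQku : ‖Qk u‖ ≤ (CQ + 1) * (4 / γ * ‖v‖) := by
    have := norm_le_norm_add_norm_sub' (Qk u) (Q u)
    have h1 := hQ u; have h2 := dQ u
    nlinarith [nu, hβ1, norm_nonneg u, hCQ]
  -- the operator letters of `G_κ`
  have nGk := norm_Gk_le_projected B₁ B₂ R Q K H a γ β βK pK ρ CP B₁k B₁k' B₂k B₂k' Rk Qk Qk' Kk Hk Gk ha hγ hβ hρ hCP hRsq hR1 hH coercive hKre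
    dB₁ dB₁' dB₂ dB₂' dR dQ dQ' dK small hHk hHkGk hρ8 hP
  have nGkB1 := norm_Gk_adjB1_le B₁ B₂ R Q K H a γ β βK pK ρ CP B₁k B₁k' B₂k B₂k' Rk Qk Qk' Kk Hk Gk ha hγ hγ1 hβ hβK hρ hρ8 hCP hRsq hR1 hH
    coercive hKre hP dB₁ dB₁' dB₂ dB₂' dR dQ dQ' dK small hHk hHkGk
  have nGkB2R := norm_Gk_adjB2_R_le B₁ B₂ R Q K H a γ β βK pK ρ CP B₁k B₁k' B₂k B₂k' Rk Qk Qk' Kk Hk Gk ha hγ hγ1 hβ hβK hρ hρ8 hCP hRsq hR1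
    hRsa hH coercive hKre hP dB₁ dB₁' dB₂ dB₂' dR dQ dQ' dK small hHk hHkGk
  have nGkB2 := norm_Gk_adjB2_le B₁ B₂ R Q K H a γ β βK pK ρ CP B₁k B₁k' B₂k B₂k' Rk Qk Qk' Kk Hk Gk ha hγ hγ1 hβ hβK hρ hρ8 hCP hRsq hR1 hRsa
    hH coercive hKre hP dB₁ dB₁' dB₂ dB₂' dR dQ dQ' dK small hHk hHkGk
  have nQ' := norm_adjQ_le Q CQ hCQ hQ
  -- the eight terms
  have t1 : ‖Gk (LinearMap.adjoint B₁ (B₁ u - B₁k u))‖ ≤ 8 / γ * (β * (4 / γ * ‖v‖)) := by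
    refine (nGkB1 _).trans (mul_le_mul_of_nonneg_left ?_ (by positivity))
    rw [norm_sub_rev]; exact (dB₁ u).trans (mul_le_mul_of_nonneg_left nu hβ)
  have t2 : ‖Gk (LinearMap.adjoint B₁ (B₁k u) - B₁k' (B₁k u))‖ ≤ 4 / γ * (β * ((8 / γ + 4 / γ) * ‖v‖)) := by
    refine (nGk _).trans (mul_le_mul_of_nonneg_left ?_ g0)
    rw [norm_sub_rev]; exact (dB₁' _).trans (mul_le_mul_of_nonneg_left nB1ku hβ)
  have t3 : ‖Gk (LinearMap.adjoint B₂ (R (B₂ u - B₂k u)))‖ ≤ 8 / γ * (β * (4 / γ * ‖v‖)) := by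
    refine (nGkB2R _).trans (mul_le_mul_of_nonneg_left ?_ (by positivity))
    rw [norm_sub_rev]; exact (dB₂ u).trans (mul_le_mul_of_nonneg_left nu hβ)
  have t4 : ‖Gk (LinearMap.adjoint B₂ (R (B₂k u) - Rk (B₂k u)))‖ ≤ (8 / γ + 4 / γ * CP) * (ρ * (((8 / γ + 4 / γ * CP) + 4 / γ) * ‖v‖)) := by
    refine (nGkB2 _).trans (mul_le_mul_of_nonneg_left ?_ (by positivity))
    rw [norm_sub_rev]; exact (dR _).trans (mul_le_mul_of_nonneg_left nB2ku hρ)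
  have t5 : ‖Gk (LinearMap.adjoint B₂ (Rk (B₂k u)) - B₂k' (Rk (B₂k u)))‖ ≤ 4 / γ * (β * (2 * (((8 / γ + 4 / γ * CP) + 4 / γ) * ‖v‖))) := by
    refine (nGk _).trans (mul_le_mul_of_nonneg_left ?_ g0)
    rw [norm_sub_rev]; exact (dB₂' _).trans (mul_le_mul_of_nonneg_left ((nRk _).trans (mul_le_mul_of_nonneg_left nB2ku (by norm_num))) hβ)
  have t6 : ‖Gk (K u - Kk u)‖ ≤ 4 / γ * (βK * (4 / γ * ‖v‖)) := by
    refine (nGk _).trans (mul_le_mul_of_nonneg_left ?_ g0)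
    rw [norm_sub_rev]; exact (dK u).trans (mul_le_mul_of_nonneg_left nu hβK)
  have t7 : ‖Gk (LinearMap.adjoint Q (Q u - Qk u))‖ ≤ 4 / γ * (CQ * (β * (4 / γ * ‖v‖))) := by
    refine (nGk _).trans (mul_le_mul_of_nonneg_left ?_ g0)
    refine (nQ' _).trans (mul_le_mul_of_nonneg_left ?_ hCQ)
    rw [norm_sub_rev]; exact (dQ u).trans (mul_le_mul_of_nonneg_left nu hβ)
  have t8 : ‖Gk (LinearMap.adjoint Q (Qk u) - Qk' (Qk u))‖ ≤ 4 / γ * (β * ((CQ + 1) * (4 / γ * ‖v‖))) := by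
    refine (nGk _).trans (mul_le_mul_of_nonneg_left ?_ g0)
    rw [norm_sub_rev]; exact (dQ' _).trans (mul_le_mul_of_nonneg_left nQku hβ)
  have t78 : ‖((a : ℝ) : 𝕜) • (Gk (LinearMap.adjoint Q (Q u - Qk u)) + Gk (LinearMap.adjoint Q (Qk u) - Qk' (Qk u)))‖ ≤
      a * (4 / γ * (CQ * (β * (4 / γ * ‖v‖))) + 4 / γ * (β * ((CQ + 1) * (4 / γ * ‖v‖)))) := by
    rw [norm_smul, RCLike.norm_ofReal, abs_of_nonneg ha]
    exact mul_le_mul_of_nonneg_left ((norm_add_le _ _).trans (add_le_add t7 t8)) ha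
  rw [key]
  refine (norm_add_le _ _).trans ?_
  refine (add_le_add ((norm_add_le _ _).trans (add_le_add ((norm_add_le _ _).trans (add_le_add ((norm_add_le _ _).trans (add_le_add
    ((norm_add_le _ _).trans (add_le_add ((norm_add_le _ _).trans (add_le_add t1 t2)) t3)) t4)) t5)) t6)) t78).trans ?_
  exact le_of_eq (by ring)

end Resolvent

end Literature.MathematicalPhysics.QuantumFieldTheory.Balaban1983to89.B9Eq326ConjugatedDeltaAResolvent

end
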